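import Summits.KontsevichZagierPeriods.KontsevichZagierPeriods.Theorems.K2SymbolChainsJensenMoveDisc

/-!
# `JensenMoveOutside` (stmt-KontsevichZagierPeriods-17758, route K2SymbolChains) — proof

`JensenMoveOutside` — JENSEN OUTSIDE THE CLOSED DISC, SMOOTH CENTRE (split child 2 of the crux
`JensenMove`, stmt-KontsevichZagierPeriods-5199): over a `ℚ`-semialgebraic base `τ ⊆ ℝⁿ` with
semialgebraic weight `h` and centre `α = α₁ + iα₂`, differentiable on `τ` with `|α|² > 1` there,
and `h (1 + |log|α|²|) ∈ L¹(τ)`, the unfolded torus representation `r` of `∫_τ h · J(α)`,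
`J(α) = ∫₀^{2π} log|e^{iφ} − α| dφ` (coordinates `(x, s, u)`, `e(s) = ((1 − s²) + 2is)/(1 + s²)`,
`u` between `1` and `W_α = |e(s) − α(x)|²`, integrand `±h(x)/((1 + s²)u)`) and the unfolded
representation `r′` of `∫_τ h · 2π log|α|` (single sheet `1 < u < |α|²`) satisfy
`[r] − [r′] ∈ KZ.relations`.

Proof (the crux-strategist's sorry-free line `Cruxes/JensenMove/Lines/jensen_move_complete.lean`,
exterior part, re-homed under `Theorems/` by lead c10 of crux stmt-KontsevichZagierPeriods-9129,
banking; statements and proofs verbatim, everything for an arbitrary subgroup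
`S ⊇ (1a) ∪ (1b) ∪ (2)`; the rotation `rotate_normal_form` and the weight extraction `weights`
are imported from the landed disc part `Theorems/K2SymbolChainsJensenMoveDisc.lean`):
* `rprime_normal_form` — the `log⁺` representation `r′` IS the signed unfolding
  `KZ.logUnfoldRep {b | init b ∈ τ} (ρ²) (h/(1 + s²))`, `ρ = |α|` (same domain since `ρ² > 1`
  kills the negative sheet, integrands agree: rule 1b with zero difference, `of_sub_of_mem_of_eqOn`);
  the integrability `h/(1+s²) · log ρ² ∈ L¹` comes from the weight hypothesis by a bounded
  measurable multiplier and the cylinder lemma `integrableOn_cyl_mul`;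
* `jensenMoveOutside_mem` — rotate `r` to the real centre `ρ` (`rotate_normal_form`, rule 2),
  put `r′` in normal form, and apply the landed `jensen_outside` (signed product rule
  `W_ρ = ρ² · W_{1/ρ}` + Jensen inside for `1/ρ`) of
  `Theorems/K2SymbolChainsJensenIsScissorsCases.lean`.
No new definitions. [Jensen 1899; Kontsevich–Zagier 2001, §1.2, rules 1)–2)] [folklore]
-/

noncomputable section

open MeasureTheory Set
open Literature.NumberTheory.Transcendental Literature.ModelTheory.ExponentialFields

namespace Summit.KontsevichZagierPeriods.K2SymbolChains

namespace JensenMoveOutsideProof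

open Literature.NumberTheory.Transcendental.KZ
open Summit.KontsevichZagierPeriods.K2SymbolChains.JensenIsScissorsProof
open Summit.KontsevichZagierPeriods.K2SymbolChains.JensenMoveSplitGlue
open Summit.KontsevichZagierPeriods.K2SymbolChains.JensenMoveDiscProof

/-- **The `log⁺` representation in normal form.** [Kontsevich–Zagier 2001, §1.1]
[folklore] -/
theorem rprime_normal_form {S : AddSubgroup Literature.NumberTheory.Transcendental.KZ.FormalRep} (hS : Literature.NumberTheory.Transcendental.KZ.domainAddRel ∪ Literature.NumberTheory.Transcendental.KZ.integrandAddRel ∪ Literature.NumberTheory.Transcendental.KZ.changeOfVariablesRel ⊆ S) : ∀ (n : ℕ) (B : Set (Fin n → ℝ)) (h α₁ α₂ : (Fin n → ℝ) → ℝ) (r' : Literature.NumberTheory.Transcendental.KZ.IntegralRep (n + 2)), Literature.ModelTheory.ExponentialFields.IsSemialgebraic ℚ B → Literature.NumberTheory.Transcendental.IsSemialgebraicFunOn ℚ B h → Literature.NumberTheory.Transcendental.IsSemialgebraicFunOn ℚ B α₁ → Literature.NumberTheory.Transcendental.IsSemialgebraicFunOn ℚ B α₂ → (∀ x ∈ B,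 1 < α₁ x ^ 2 + α₂ x ^ 2) → MeasureTheory.IntegrableOn (fun x => h x * (1 + |Real.log (α₁ x ^ 2 + α₂ x ^ 2)|)) B → r'.domain = {w | (fun i : Fin n => w (Fin.castAdd 2 i)) ∈ B ∧ 1 < w (Fin.natAdd n 1) ∧ w (Fin.natAdd n 1) < α₁ (fun i : Fin n => w (Fin.castAdd 2 i)) ^ 2 + α₂ (fun i : Fin n => w (Fin.castAdd 2 i)) ^ 2} → (∀ w ∈ r'.domain, r'.integrand w = h (fun i : Fin n => w (Fin.castAdd 2 i)) / ((1 + w (Fin.natAdd n 0) ^ 2) * w (Fin.natAdd n 1))) → ∃ R'' : Literature.NumberTheory.Transcendental.KZ.IntegralRep (n + 1 + 1), R''.domain = Literature.NumberTheory.Transcendental.KZ.logUnfoldDomain {b : Fin (n + 1) → ℝ | Fin.init b ∈ B} (fun b => Real.sqrt (α₁ (Fin.init b) ^ 2 + α₂ (Fin.init b) ^ 2) ^ 2) ∧ R''.integrand = Literature.NumberTheory.Transcendental.KZ.logUnfoldIntegrand (fun b => h (Fin.init b) / (1 + b (Fin.last n) ^ 2)) ∧ Literature.NumberTheory.Transcendental.KZ.of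 r' - Literature.NumberTheory.Transcendental.KZ.of R'' ∈ S := by
  intro n B h α₁ α₂ r' hB hh hα₁ hα₂ hreg hint hr'd hr'i
  have hBm : MeasurableSet B := IsSemialgebraic.measurableSet_holds hB
  set T : Set (Fin (n + 1) → ℝ) := {b | Fin.init b ∈ B} with hT_def
  have hT : IsSemialgebraic ℚ T := isSemialgebraic_cyl hB
  set G : (Fin (n + 1) → ℝ) → ℝ := fun b => h (Fin.init b) / (1 + b (Fin.last n) ^ 2) with hG_def
  have hGT : IsSemialgebraicFunOn ℚ T G := isSemialgebraicFunOn_weight hh hT subset_rfl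
  set ρ : (Fin n → ℝ) → ℝ := fun x => Real.sqrt (α₁ x ^ 2 + α₂ x ^ 2) with hρ_def
  have hρs : IsSemialgebraicFunOn ℚ B ρ := isSemialgebraicFunOn_modulus hα₁ hα₂
  set V : (Fin (n + 1) → ℝ) → ℝ := fun b => Real.sqrt (α₁ (Fin.init b) ^ 2 + α₂ (Fin.init b) ^ 2) ^ 2
    with hV_def
  have h0 : ∀ x, 0 ≤ α₁ x ^ 2 + α₂ x ^ 2 := fun x => by positivity
  have hVρ2 : ∀ b, V b = α₁ (Fin.init b) ^ 2 + α₂ (Fin.init b) ^ 2 := fun b => by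
    simp only [hV_def]; exact Real.sq_sqrt (h0 _)
  have hVT : IsSemialgebraicFunOn ℚ T V :=
    ((IsSemialgebraicFunOn.mul_holds hρs hρs).comp_init.mono subset_rfl hT).congr fun b _ => by
      simp [hV_def, hρ_def, sq]
  have hV0 : ∀ b ∈ T, 0 ≤ V b := fun b _ => by simp only [hV_def]; positivity
  have hV1 : ∀ b ∈ T, 1 < V b := fun b hb => by rw [hVρ2]; exact hreg _ hb
  have hZ : volume {b | b ∈ T ∧ V b = 0} = 0 := by
    rw [show {b | b ∈ T ∧ V b = 0} = (∅ : Set (Fin (n + 1) → ℝ)) by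
      ext b; simp only [mem_setOf_eq, mem_empty_iff_false, iff_false, not_and]
      exact fun hb hV => by have := hV1 b hb; rw [hV] at this; exact absurd this (by norm_num)]
    exact measure_empty
  -- integrability of `G · log V` on `T` from the weight hypothesis (bounded multiplier, then cylinder)
  have hlogB : IntegrableOn (fun x => h x * Real.log (α₁ x ^ 2 + α₂ x ^ 2)) B := by
    set W : (Fin n → ℝ) → ℝ := B.indicator (fun x => α₁ x ^ 2 + α₂ x ^ 2) with hW_def
    have hρ2 : IsSemialgebraicFunOn ℚ B (fun x => α₁ x ^ 2 + α₂ x ^ 2) :=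
      (IsSemialgebraicFunOn.add_holds (IsSemialgebraicFunOn.mul_holds hα₁ hα₁)
        (IsSemialgebraicFunOn.mul_holds hα₂ hα₂)).congr fun x _ => by
        simp only [Pi.add_apply, Pi.mul_apply]; ring
    have hWm : Measurable W := hρ2.measurable_indicator_of_tarskiSeidenberg tarski_seidenberg_real_holds hBm
    have hWB : ∀ x ∈ B, W x = α₁ x ^ 2 + α₂ x ^ 2 := fun x hx => by simp [hW_def, indicator_of_mem hx]
    have hL : Measurable fun x => Real.log (W x) := Real.measurable_log.comp hWm
    set m : (Fin n → ℝ) → ℝ := fun x => Real.log (W x) * (1 + |Real.log (W x)|)⁻¹ with hm_def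
    have hm : Measurable m := hL.mul (measurable_const.add hL.abs).inv
    have hpos : ∀ x, 0 < 1 + |Real.log (W x)| := fun x => by positivity
    have hb : ∀ x, |m x| ≤ 1 := fun x => by
      have ha := abs_nonneg (Real.log (W x))
      show |Real.log (W x) * (1 + |Real.log (W x)|)⁻¹| ≤ 1
      rw [abs_mul, abs_inv, abs_of_pos (hpos x), ← div_eq_mul_inv, div_le_one (hpos x)]
      linarith
    refine (integrableOn_measurable_bdd_mul hint hm hb).congr_fun (fun x hx => ?_) hBm
    have hne : (1 + |Real.log (α₁ x ^ 2 + α₂ x ^ 2)| : ℝ) ≠ 0 := by positivity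
    simp only [hm_def, hWB x hx]
    field_simp
  have hGlogV : IntegrableOn (fun b => G b * Real.log (V b)) T := by
    have := integrableOn_cyl_mul (B := B) (f := fun x => h x * Real.log (α₁ x ^ 2 + α₂ x ^ 2))
      (g := fun s : ℝ => (1 + s ^ 2)⁻¹) hlogB integrable_inv_one_add_sq
    refine this.congr_fun (fun b _ => ?_) (IsSemialgebraic.measurableSet_holds hT)
    simp only [hG_def, hVρ2]
    ring
  set R'' : IntegralRep (n + 1 + 1) := logUnfoldRep T V G hT hGT hVT hV0 hZ hGlogV with hR''
  refine ⟨R'', rfl, rfl, ?_⟩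
  -- `r′` and `R″` have the same domain and integrands agreeing on it
  have hdom : R''.domain = r'.domain := by
    rw [hr'd]
    show logUnfoldDomain T V = _
    ext w
    simp only [logUnfoldDomain, mem_setOf_eq, hT_def]
    constructor
    · rintro ⟨hb, h1 | h2⟩
      · refine ⟨hb, h1.1, ?_⟩
        have := h1.2; rw [hVρ2] at this; exact this
      · exfalso; have := hV1 _ hb; linarith [h2.1, h2.2]
    · rintro ⟨hb, hu1, hu2⟩
      refine ⟨hb, Or.inl ⟨hu1, ?_⟩⟩
      rw [hVρ2]; exact hu2
  refine of_sub_of_mem_of_eqOn hS hdom (fun w hw => ?_)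
  rw [hr'i w hw]
  rw [hr'd] at hw
  have hu : 1 < w (Fin.natAdd n 1) := hw.2.1
  show h (fun i : Fin n => w (Fin.castAdd 2 i)) / ((1 + w (Fin.natAdd n 0) ^ 2) * w (Fin.natAdd n 1)) =
    (if 1 < w (Fin.natAdd n 1) then (1:ℝ) else -1) *
      (h (fun i : Fin n => w (Fin.castAdd 2 i)) / (1 + w (Fin.natAdd n 0) ^ 2)) / w (Fin.natAdd n 1)
  rw [if_pos hu, one_mul, div_div]

/-- **Jensen outside the closed disc, smooth centre** (the statement of route item
`K2SymbolChains.JensenMoveOutside`, spelled out). [Jensen 1899; Kontsevich–Zagier 2001, §1.2] [folklore] -/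
theorem jensenMoveOutside_mem {S : AddSubgroup Literature.NumberTheory.Transcendental.KZ.FormalRep} (hS : Literature.NumberTheory.Transcendental.KZ.domainAddRel ∪ Literature.NumberTheory.Transcendental.KZ.integrandAddRel ∪ Literature.NumberTheory.Transcendental.KZ.changeOfVariablesRel ⊆ S) :
    ∀ (n : ℕ) (τ : Set (Fin n → ℝ)) (h α₁ α₂ : (Fin n → ℝ) → ℝ) (r r' : Literature.NumberTheory.Transcendental.KZ.IntegralRep (n + 2)), Literature.ModelTheory.ExponentialFields.IsSemialgebraic ℚ τ → Literature.NumberTheory.Transcendental.IsSemialgebraicFunOn ℚ τ h → Literature.NumberTheory.Transcendental.IsSemialgebraicFunOn ℚ τ α₁ → Literature.NumberTheory.Transcendental.IsSemialgebraicFunOn ℚ τ α₂ → (∀ x ∈ τ, DifferentiableAt ℝ α₁ x ∧ DifferentiableAt ℝ α₂ x) → (∀ x ∈ τ, 1 < α₁ x ^ 2 + α₂ x ^ 2) → MeasureTheory.IntegrableOn (fun x => h x * (1 + |Real.log (α₁ x ^ 2 + α₂ x ^ 2)|)) τ → r.domain = {w | (fun i : Fin n => w (Fin.castAdd 2 i))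 ∈ τ ∧ ((1 < w (Fin.natAdd n 1) ∧ w (Fin.natAdd n 1) < (((1 - w (Fin.natAdd n 0) ^ 2) / (1 + w (Fin.natAdd n 0) ^ 2) - α₁ (fun i : Fin n => w (Fin.castAdd 2 i))) ^ 2 + (2 * w (Fin.natAdd n 0) / (1 + w (Fin.natAdd n 0) ^ 2) - α₂ (fun i : Fin n => w (Fin.castAdd 2 i))) ^ 2)) ∨ ((((1 - w (Fin.natAdd n 0) ^ 2) / (1 + w (Fin.natAdd n 0) ^ 2) - α₁ (fun i : Fin n => w (Fin.castAdd 2 i))) ^ 2 + (2 * w (Fin.natAdd n 0) / (1 + w (Fin.natAdd n 0) ^ 2) - α₂ (fun i : Fin n => w (Fin.castAdd 2 i))) ^ 2) < w (Fin.natAdd n 1) ∧ w (Fin.natAdd n 1) < 1))} → (∀ w ∈ r.domain, r.integrand w = (if 1 < w (Fin.natAdd n 1) then (1:ℝ) else -1) * h (fun i : Fin n => w (Fin.castAdd 2 i)) / ((1 + w (Fin.natAdd n 0) ^ 2) * w (Fin.natAdd n 1))) → r'.domain = {w | (fun i : Fin n => w (Fin.castAdd 2 i)) ∈ τ ∧ 1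 < w (Fin.natAdd n 1) ∧ w (Fin.natAdd n 1) < α₁ (fun i : Fin n => w (Fin.castAdd 2 i)) ^ 2 + α₂ (fun i : Fin n => w (Fin.castAdd 2 i)) ^ 2} → (∀ w ∈ r'.domain, r'.integrand w = h (fun i : Fin n => w (Fin.castAdd 2 i)) / ((1 + w (Fin.natAdd n 0) ^ 2) * w (Fin.natAdd n 1))) → Literature.NumberTheory.Transcendental.KZ.of r - Literature.NumberTheory.Transcendental.KZ.of r' ∈ S := by
  have hrot := rotate_normal_form hS
  have hw := @weights
  have hrp := rprime_normal_form hS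
  intro n τ h α₁ α₂ r r' hτ hh hα₁ hα₂ hdiff hreg hint hrd hri hr'd hr'i
  have hne : ∀ x ∈ τ, α₁ x ^ 2 + α₂ x ^ 2 ≠ 0 := fun x hx => by have := hreg x hx; positivity
  obtain ⟨R', hR'd, hR'i, e1⟩ := hrot n τ h α₁ α₂ r hτ hh hα₁ hα₂ hdiff hne hrd hri
  obtain ⟨R'', hR''d, hR''i, e2⟩ := hrp n τ h α₁ α₂ r' hτ hh hα₁ hα₂ hreg hint hr'd hr'i
  obtain ⟨hhi, hhlog⟩ := hw n τ h α₁ α₂ hτ hh hα₁ hα₂ hint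
  set ρ : (Fin n → ℝ) → ℝ := fun x => Real.sqrt (α₁ x ^ 2 + α₂ x ^ 2) with hρ_def
  have hρs : IsSemialgebraicFunOn ℚ τ ρ := isSemialgebraicFunOn_modulus hα₁ hα₂
  have hρ1 : ∀ x ∈ τ, 1 < ρ x := fun x hx => by
    have := Real.sqrt_lt_sqrt zero_le_one (hreg x hx)
    simpa [hρ_def] using this
  have hρd : ∀ x ∈ τ, DifferentiableAt ℝ ρ x := fun x hx =>
    differentiableAt_modulus (hdiff x hx).1 (hdiff x hx).2 (hne x hx)
  have e3 : of R' - of R'' ∈ S :=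
    jensen_outside hS (B := τ) (h := h) (ρ := ρ) hτ hh hρs hρ1 hρd hhi hhlog R' R''
      hR'd (by rw [hR'i]; exact fun _ _ => rfl) hR''d (by rw [hR''i]; exact fun _ _ => rfl)
  have : of r - of r' = (of r - of R') + (of R' - of R'') - (of r' - of R'') := by abel
  rw [this]
  exact S.sub_mem (S.add_mem e1 e3) e2

end JensenMoveOutsideProof

open JensenMoveOutsideProof JensenMoveSplitGlue in
/-- **`JensenMoveOutside`** (route K2SymbolChains, stmt-KontsevichZagierPeriods-17758): over a
`ℚ`-semialgebraic base with semialgebraic weight `h` and smooth centre `α`, `|α|² > 1`,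
`h (1 + |log|α|²|) ∈ L¹`, the unfolded torus representation `r` of `∫ h · J(α)` and the unfolded
representation `r′` of `∫ h · 2π log|α|` satisfy `[r] − [r′] ∈ KZ.relations`. Proof:
`jensenMoveOutside_mem` for `S = KZ.relations` (rotation to a real centre, `r′` in `log⁺` normal
form, Jensen outside by the signed product rule + Jensen inside for `1/ρ`). [Jensen 1899;
Kontsevich–Zagier 2001, §1.2, rules 1)–2)] [folklore] -/
theorem jensenMoveOutside_proof :
    Summit.KontsevichZagierPeriods.KontsevichZagierPeriods.Theses.K2SymbolChains.JensenMoveOutside :=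
  jensenMoveOutside_mem scissors_subset_relations

end Summit.KontsevichZagierPeriods.K2SymbolChains
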